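import Summits.HubbardSuperconductivity.HubbardSuperconductivity.Theses.ChiralWindow
import Literature.MathematicalPhysics.QuantumLattice.HubbardRingPerronFrobeniusProofs
import Literature.MathematicalPhysics.QuantumLattice.HubbardWave0LiebProofs
import Literature.MathematicalPhysics.QuantumLattice.FinDimSpectrumProofs
import Literature.MathematicalPhysics.QuantumLattice.ApproximatingHamiltonianProofs
import Summits.HubbardSuperconductivity.HubbardSuperconductivity.Theorems.ChiralWindowCwThesisBlockGroundEnergy
import Summits.HubbardSuperconductivity.HubbardSuperconductivity.Theorems.ChiralWindowCwThesisParticipationChebyshev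
import Summits.HubbardSuperconductivity.HubbardSuperconductivity.Theorems.ChiralWindowCwThesisSectorGroundStateRestrict
import Summits.HubbardSuperconductivity.HubbardSuperconductivity.Theorems.BalabanIRBirEveryGroundState
import HarnessLib

/-!
# `CwThesis` (stmt-HubbardSuperconductivity-10438) — line `SketchIdeator2` (card
`participation-chebyshev-ring`, idea B of `Cruxes/CwThesis/SketchIdeator2.lean`), lead skeleton

Crux (route `ChiralWindow`, target/auto-crux, rank 0):
`Summit.HubbardSuperconductivity.HubbardSuperconductivity.Theses.ChiralWindow.CwThesis` —
`∃ U₀ > 0, ∀ U ∈ (0,U₀), ∃ δ ∈ [3/10,12/25]`, the summit matrix at `(U, δ)` (every normalised even-torus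
`(N_L, S^z = 0)`-sector ground-state sequence of `hubbardTorus 2 L 1 U`, `N_L = 2⌊(1-δ)L²/2⌋`, has
`d_{x²-y²}` pair-field long-range order).

Line (card `Cruxes/CwThesis/Ideas/participation-chebyshev-ring.md`, sketch `SketchIdeator2.lean`
§ "Idea B"): the **participation-number Chebyshev inequality** turns ONE canonical Gibbs state of the pure
torus at the "log-cold" temperature `β = κL` into a floor for EVERY sector ground state, with no source,
no purity, no symmetry resolution and no entropy count. Three layers (the sketch's block predicate
`s.card = N ∧ 2·#{spin 0} = N` is RESHAPED to Lieb's `(n,n)` occupation predicate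
`#upPart s = n ∧ #downPart s = n`, `2n = N_L`, the idiom of line `SketchIdeator3`, so that the landed block
bookkeeping of that line is reused; sides run along `L = 2(k+1)` eventually in `k`):

* ENGINE `stub_ringTraces` (C⁺ = the card's `RingTraces`; summit-hard, held by the lead): for every weak
  `U` there are `δ_U ∈ [3/10,12/25]`, a temperature slope `κ > 0`, a centre `c > 0` and a relative loss
  `θ ∈ [0,1)` such that eventually along `L = 2(k+1)`, on the `(n,n)` block (`H_p`, `Q_p` the compressions
  of `hubbardTorus 2 L 1 U` and `Q = Δ_d†Δ_d = (pairField dWaveFormFactor L)ᴴ pairField …`), with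
  `D = Q_p - cL⁴`:  `Re tr(D² e^{-κL H_p}) · Re Z(κL) ≤ (θ c L⁴)² · Re Z(2κL)` — the thermal mean-square
  deviation of the pair intensity about `cL⁴` times the participation number `Z(β)²/Z(2β)` is at most
  `(θcL⁴)²` (a "thin ring" for `|Δ_d/L²|²` in the `U(1)`-symmetric canonical state; one 4-fermion and one
  8-fermion equal-time trace plus a ratio of partition functions);
* TRANSFER `stub_participationChebyshev` (finite-dimensional, provable now; the card's first lemma): for
  Hermitian `H`, `X`, real `c`, `β > 0` and every normalised ground-state vector `ψ` of `H`
  (`Hψ = E₀ψ`): `c - √( Re tr((X-c)² e^{-βH}) · Re Z(β) / Re Z(2β) ) ≤ Re ⟨ψ, Xψ⟩`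
  (`(X-c)² ⪰ 0`; `e^{-βH} ⪰ e^{-βE₀}|ψ⟩⟨ψ|`; `e^{-βE₀} Z(β) ≥ Z(2β)`; Cauchy–Schwarz);
* BOOKKEEPING `stub_sectorGroundStateRestrict` (linear algebra, provable now): a sector ground state `ψ` of a
  Hermitian `H` on the Fock space of the torus (`IsGroundStateInSector H (2n) 0 ψ`, `n ≤ L²`) restricts to
  a vector of the `(n,n)` block with the same norm, the same expectation of every compressed observable
  `A_p`, and which is an eigenvector of `H_p` for the eigenvalue `groundEnergy H_p` (ψ vanishes off the
  block, `mem_szSector_two_mul_zero_iff`; block ground energy = sector energy, the landed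
  `Theorems.CwThesis.stub_blockGroundEnergy` of line `SketchIdeator3`).

Composition `CwThesis_of` below is sorry-free modulo the three stubs; v2 (2026-08-16): the two provable stubs are
LANDED (p97222, p98008) and consumed here by name — the only remaining `sorry` is the engine. Originally: ring traces + Chebyshev give
`(1-θ)c·L⁴ ≤ Re⟨ψ, Q ψ⟩` for every normalised sector ground state at every large even side
(`floor_of_ringTrace`, proved here), and the tree's `hasLRO_of_forall_groundState_bound` turns the floor
into the summit matrix at `(U, δ_U)`.

Disproof used (`Cruxes/CwThesis/Disproof.lean`, cdisprove gen 1 cycle 1 FINAL, no kill; `Negative/*` landed;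
re-read 2026-08-16 by this lead): §5 `cwThesis_iff_floor` — the composition ends exactly in the floor normal
form with `a = (1-θ)c` (every normalised sector ground state of the prescribed block); §6
`not_hasDWavePairFieldLROAt_zero` / §7 `cwThesis_false_uniformFloor` — ALL constants of the engine
(`δ_U, κ, c, θ`, the threshold `k₀`) are quantified AFTER `U ∈ (0,U₀)` and must degenerate as `U → 0⁺`
(`c ≍ e^{-2C/U²}`; at `U = 0` no centre `c > 0` with small mean-square deviation exists, since every free
sector ground state has pair intensity `≤ 320 L²`, so `stub_ringTraces` at `U = 0` would contradict §6 through
`floor_of_ringTrace` — consistent with `0 < U`); §3 — the three admissibility clauses are consumed inside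
`hasLRO_of_forall_groundState_bound`; §2 — nothing fixes `δ` before `U`. No `-- Targets` section bears on
this line's stubs yet (the disprover's targets so far concern line `SketchIdeator3`).
-/

noncomputable section

namespace Summit.HubbardSuperconductivity.HubbardSuperconductivity.Cruxes.CwThesis.RingLine

open Matrix Filter Literature.MathematicalPhysics.QuantumLattice Literature.Probability.LatticeModels
open Summit.HubbardSuperconductivity.HubbardSuperconductivity.Theses
open Summit.HubbardSuperconductivity.HubbardSuperconductivity.Theorems
open scoped ComplexOrder

set_option linter.dupNamespace false
-- the `(n,n)`-sector index type `{s : Finset (Orb Λ) // …}` needs a larger instance budget for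
-- `DecidableEq` (structural instance through `Lex (Fin 2 → Fin L)`; tree precedent: GaugedHubbardTorus)
set_option synthInstance.maxSize 512

/-! ### The three stubs (registered on stmt-HubbardSuperconductivity-10438) -/

/-- STUB (ENGINE, C⁺ = `RingTraces`; summit-hard — the weak-coupling construction; held by the lead):
**ring traces at the log-cold temperature.** There is `U₀ > 0` such that for every `U ∈ (0, U₀)` there
are a doping `δ ∈ [3/10, 12/25]` and constants `κ, c > 0`, `θ ∈ [0,1)` such that, for all large `k`, with
`L = 2(k+1)`, `n = ⌊(1-δ)L²/2⌋`, `p` Lieb's `(n,n)` occupation sector, `H_p`, `Q_p` the compressions of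
`hubbardTorus 2 L 1 U` and `Δ_d†Δ_d` to `p`, and `D = Q_p - cL⁴·1`:
`Re tr(D·D·e^{-κL·H_p}) · Re Z_{κL}(H_p) ≤ (θ c L⁴)² · Re Z_{2κL}(H_p)`.
Intended proof: multiscale fermionic expansion to the gap scale at the Kohn–Luttinger crossing line
`δ*(U)` (certified by `CwKLChiralWindow`), fully gapped chiral reference state `ψ₁g₁ + iψ₂g₂` below it,
on the anisotropic torus `L × L × κL`; centre `c ≍ m_d(U)² ≍ e^{-2C/U²}`, participation number
`Z(β)²/Z(2β) = O(1)` (Debye phonon gas; `≍ √(L/κ)` with an `E`-partner spin tower), mean-square deviation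
of `|Δ_d/L²|²` of relative size `O(log L / L²) + O((log L/(κL))²)`. -/
theorem stub_ringTraces :
    ∃ U₀ : ℝ, 0 < U₀ ∧ ∀ U ∈ Set.Ioo (0:ℝ) U₀, ∃ δ ∈ Set.Icc (3/10 : ℝ) (12/25),
      ∃ κ c θ : ℝ, 0 < κ ∧ 0 < c ∧ 0 ≤ θ ∧ θ < 1 ∧
        ∀ᶠ k : ℕ in atTop,
          let L : ℕ := 2 * (k + 1)
          let n : ℕ := ⌊(1 - δ) * (L : ℝ) ^ 2 / 2⌋₊
          let Hp := (hubbardTorus 2 L 1 U).toBlock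
            (fun s => (upPart s).card = n ∧ (downPart s).card = n)
            (fun s => (upPart s).card = n ∧ (downPart s).card = n)
          let Qp := ((pairField dWaveFormFactor L)ᴴ * pairField dWaveFormFactor L).toBlock
            (fun s => (upPart s).card = n ∧ (downPart s).card = n)
            (fun s => (upPart s).card = n ∧ (downPart s).card = n)
          let D := Qp - ((c * (L : ℝ) ^ 4 : ℝ) : ℂ) • 1
          (D * D * Matrix.gibbsWeight (κ * (L : ℝ)) Hp).trace.re *
              (Matrix.partitionFn (κ * (L : ℝ)) Hp).re ≤
            (θ * c * (L : ℝ) ^ 4) ^ 2 * (Matrix.partitionFn (2 * (κ * (L : ℝ))) Hp).re := by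
  sorry

/-- STUB (M; finite-dimensional, provable now; the card's first lemma): **participation-number
Chebyshev.** For Hermitian `H`, `X` on a finite index type, `β > 0`, a real centre `c` and every
normalised ground-state vector `ψ` of `H` (`H ψ = E₀ ψ`, `E₀ = groundEnergy H`):
`c - √( Re tr((X - c)·(X - c)·e^{-βH}) · Re Z(β) / Re Z(2β) ) ≤ Re ⟨ψ, X ψ⟩`.
Proof: `(c - Re⟨ψ,Xψ⟩)² ≤ ⟨ψ,(X-c)²ψ⟩` (Cauchy–Schwarz / Jensen for the PSD square);
`e^{-βH} - e^{-βE₀}|ψ⟩⟨ψ| ⪰ 0` (ψ is an eigenvector of `e^{-βH}` for its top eigenvalue `e^{-βE₀}`,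
`exp_smul_mulVec_of_mulVec_eq`), so `e^{-βE₀}⟨ψ,(X-c)²ψ⟩ ≤ Re tr((X-c)² e^{-βH})`; and
`Re Z(2β) = Σ e^{-2βEᵢ} ≤ e^{-βE₀} Σ e^{-βEᵢ} = e^{-βE₀} Re Z(β)` (`partitionFn_eq_sum_exp`,
`groundEnergy_eq_iInf_eigenvalues_holds`); combine and take square roots. [folklore] -/
theorem stub_participationChebyshev {m : Type*} [Fintype m] [DecidableEq m]
    (H X : Matrix m m ℂ) (hH : H.IsHermitian) (hX : X.IsHermitian) {β : ℝ} (hβ : 0 < β) (c : ℝ)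
    (ψ : m → ℂ) (hψ : star ψ ⬝ᵥ ψ = 1) (hHψ : H *ᵥ ψ = ((H.groundEnergy : ℝ) : ℂ) • ψ) :
    c - Real.sqrt (((X - (c : ℂ) • 1) * (X - (c : ℂ) • 1) * Matrix.gibbsWeight β H).trace.re *
        (Matrix.partitionFn β H).re / (Matrix.partitionFn (2 * β) H).re) ≤
      (star ψ ⬝ᵥ X *ᵥ ψ).re :=
  -- LANDED p97222 (Theorems/ChiralWindowCwThesisParticipationChebyshev.lean)
  Theorems.CwThesis.stub_participationChebyshev H X hH hX hβ c ψ hψ hHψ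

/-- STUB (M; linear algebra, provable now): **a sector ground state restricts to a block ground vector.**
For a Hermitian `H` and any `A` on the fermionic Fock space of the torus of side `L`, `n ≤ L²`, and a
ground state `ψ` of `H` in the joint sector `(N, S^z) = (2n, 0)` (`IsGroundStateInSector`), the
restriction `φ s := ψ s.1` of `ψ` to Lieb's `(n,n)` occupation sets has the same norm as `ψ`, the same
expectation of the compression `A.toBlock p p` as `ψ` has of `A`, and is an eigenvector of the compressed
Hamiltonian `H.toBlock p p` for the eigenvalue `groundEnergy (H.toBlock p p)`: `ψ` vanishes off the block
(`mem_szSector_two_mul_zero_iff`), so restriction intertwines `A` with `A_p` on `ψ` with no invariance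
needed, and the sector energy `minEnergyOn H (szSector (2n) 0)` is the block ground energy
(`Theorems.CwThesis.stub_blockGroundEnergy`). [folklore] -/
theorem stub_sectorGroundStateRestrict (L : ℕ) {n : ℕ} (hn : n ≤ L ^ 2)
    (H A : Matrix (Finset (Orb (FermionTorus 2 L))) (Finset (Orb (FermionTorus 2 L))) ℂ)
    (hH : H.IsHermitian) (ψ : Fock (Orb (FermionTorus 2 L)))
    (hψ : IsGroundStateInSector H (2 * n) 0 ψ) :
    star (fun s : {s : Finset (Orb (FermionTorus 2 L)) // (upPart s).card = n ∧ (downPart s).card = n} =>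
          ψ s.1) ⬝ᵥ
        (fun s : {s : Finset (Orb (FermionTorus 2 L)) // (upPart s).card = n ∧ (downPart s).card = n} =>
          ψ s.1) = star ψ ⬝ᵥ ψ ∧
      star (fun s : {s : Finset (Orb (FermionTorus 2 L)) // (upPart s).card = n ∧ (downPart s).card = n} =>
            ψ s.1) ⬝ᵥ
          (A.toBlock (fun s => (upPart s).card = n ∧ (downPart s).card = n)
              (fun s => (upPart s).card = n ∧ (downPart s).card = n)) *ᵥ
            (fun s : {s : Finset (Orb (FermionTorus 2 L)) //
              (upPart s).card = n ∧ (downPart s).card = n} => ψ s.1) = star ψ ⬝ᵥ A *ᵥ ψ ∧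
      (H.toBlock (fun s => (upPart s).card = n ∧ (downPart s).card = n)
          (fun s => (upPart s).card = n ∧ (downPart s).card = n)) *ᵥ
          (fun s : {s : Finset (Orb (FermionTorus 2 L)) // (upPart s).card = n ∧ (downPart s).card = n} =>
            ψ s.1) =
        (((H.toBlock (fun s => (upPart s).card = n ∧ (downPart s).card = n)
            (fun s => (upPart s).card = n ∧ (downPart s).card = n)).groundEnergy : ℝ) : ℂ) •
          (fun s : {s : Finset (Orb (FermionTorus 2 L)) // (upPart s).card = n ∧ (downPart s).card = n} =>
            ψ s.1) :=
  -- LANDED p98008 (Theorems/ChiralWindowCwThesisSectorGroundStateRestrict.lean)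
  Theorems.CwThesis.stub_sectorGroundStateRestrict L hn H A hH ψ hψ

/-! ### Composition (sorry-free modulo the stubs) -/

/-- **Ring trace + Chebyshev ⇒ ground-state floor (abstract).** For Hermitian `H`, `X` on a finite
index type, `β > 0`, a centre `c`, a relative loss `θ ≥ 0` with `θ·c ≥ 0`, and the ring-trace bound
`Re tr((X-c)² e^{-βH}) · Re Z(β) ≤ (θc)² · Re Z(2β)`, every normalised ground-state vector `ψ` of `H`
has `(1-θ)·c ≤ Re⟨ψ, Xψ⟩` (`stub_participationChebyshev`; `Re Z(2β) > 0`). [folklore] -/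
theorem floor_of_ringTrace {m : Type*} [Fintype m] [DecidableEq m]
    (H X : Matrix m m ℂ) (hH : H.IsHermitian) (hX : X.IsHermitian) {β c θ : ℝ} (hβ : 0 < β)
    (hθc : 0 ≤ θ * c)
    (hring : ((X - (c : ℂ) • 1) * (X - (c : ℂ) • 1) * Matrix.gibbsWeight β H).trace.re *
        (Matrix.partitionFn β H).re ≤ (θ * c) ^ 2 * (Matrix.partitionFn (2 * β) H).re)
    (ψ : m → ℂ) (hψ : star ψ ⬝ᵥ ψ = 1) (hHψ : H *ᵥ ψ = ((H.groundEnergy : ℝ) : ℂ) • ψ) :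
    (1 - θ) * c ≤ (star ψ ⬝ᵥ X *ᵥ ψ).re := by
  have hcheb := stub_participationChebyshev H X hH hX hβ c ψ hψ hHψ
  -- the index type is nonempty since `ψ` is a unit vector
  rcases isEmpty_or_nonempty m with hm | hm
  · exfalso
    have : star ψ ⬝ᵥ ψ = 0 := by simp [dotProduct]
    rw [this] at hψ
    exact zero_ne_one hψ
  have hZ2 : 0 < (Matrix.partitionFn (2 * β) H).re := partitionFn_re_pos hH (2 * β)
  have hquot : ((X - (c : ℂ) • 1) * (X - (c : ℂ) • 1) * Matrix.gibbsWeight β H).trace.re *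
      (Matrix.partitionFn β H).re / (Matrix.partitionFn (2 * β) H).re ≤ (θ * c) ^ 2 := by
    rw [div_le_iff₀ hZ2]
    exact hring
  have hsqrt : Real.sqrt (((X - (c : ℂ) • 1) * (X - (c : ℂ) • 1) * Matrix.gibbsWeight β H).trace.re *
      (Matrix.partitionFn β H).re / (Matrix.partitionFn (2 * β) H).re) ≤ θ * c := by
    calc Real.sqrt _ ≤ Real.sqrt ((θ * c) ^ 2) := Real.sqrt_le_sqrt hquot
      _ = θ * c := Real.sqrt_sq hθc
  linarith

/-- **The line closes the crux modulo its stubs**: `stub_ringTraces` (engine) with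
`stub_participationChebyshev` and `stub_sectorGroundStateRestrict` give, for every weak `U`, a doping
`δ_U` of the window and the every-ground-state floor `(1-θ)c·L⁴ ≤ Re⟨ψ, Δ_d†Δ_d ψ⟩` at every large even
side `L = 2(k+1)` (`floor_of_ringTrace` on the `(n,n)` block), and `hasLRO_of_forall_groundState_bound`
turns the floor into the summit matrix at `(U, δ_U)`, i.e. `ChiralWindow.CwThesis`. -/
theorem CwThesis_of : ChiralWindow.CwThesis := by
  obtain ⟨U₀, hU₀, hU⟩ := stub_ringTraces
  refine ⟨U₀, hU₀, fun U hUm => ?_⟩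
  obtain ⟨δ, hδ, κ, c, θ, hκ, hc, hθ, hθ1, hev⟩ := hU U hUm
  refine ⟨δ, hδ, ?_⟩
  intro N ψ hadm
  obtain ⟨k₀, hk₀⟩ := Filter.eventually_atTop.1 hev
  have hθc : 0 ≤ θ * c := mul_nonneg hθ hc.le
  have hfloorpos : 0 < (1 - θ) * c := mul_pos (by linarith) hc
  refine hasLRO_of_forall_groundState_bound U δ ((1 - θ) * c) hfloorpos (2 * (k₀ + 1)) ?_ N ψ hadm
  intro L _ hL hLe φ hgs hunit
  -- write the even side as `L = 2(k+1)` with `k ≥ k₀`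
  obtain ⟨r, hr⟩ := hLe
  obtain ⟨k, hk, rfl⟩ : ∃ k, k₀ ≤ k ∧ L = 2 * (k + 1) := ⟨r - 1, by omega, by omega⟩
  have hring := hk₀ k hk
  dsimp only at hring
  -- names
  set n : ℕ := ⌊(1 - δ) * (((2 * (k + 1) : ℕ)) : ℝ) ^ 2 / 2⌋₊ with hn_def
  set H := hubbardTorus 2 (2 * (k + 1)) 1 U with hH_def
  set Q : Matrix (Finset (Orb (FermionTorus 2 (2 * (k + 1)))))
      (Finset (Orb (FermionTorus 2 (2 * (k + 1))))) ℂ :=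
    (pairField dWaveFormFactor (2 * (k + 1)))ᴴ * pairField dWaveFormFactor (2 * (k + 1)) with hQ_def
  have hH : H.IsHermitian := hubbardTorus_isHermitian (hamiltonian_isHermitian_and_commute_holds _) 1 U
  have hQ : Q.IsHermitian := isHermitian_conjTranspose_mul_self _
  -- `n ≤ L²`
  have hδ0 : (0 : ℝ) ≤ δ := by linarith [hδ.1]
  have hn : n ≤ (2 * (k + 1)) ^ 2 := by
    have hx : (1 - δ) * (((2 * (k + 1) : ℕ)) : ℝ) ^ 2 / 2 ≤ (((2 * (k + 1)) ^ 2 : ℕ) : ℝ) := by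
      push_cast
      nlinarith [sq_nonneg (((2 * (k + 1) : ℕ)) : ℝ)]
    exact (Nat.floor_mono hx).trans (Nat.floor_natCast _).le
  -- restrict the sector ground state to the `(n,n)` block
  obtain ⟨hnorm, hexp, heig⟩ := stub_sectorGroundStateRestrict (2 * (k + 1)) hn H Q hH φ hgs
  set φp : {s : Finset (Orb (FermionTorus 2 (2 * (k + 1)))) //
      (upPart s).card = n ∧ (downPart s).card = n} → ℂ := fun s => φ s.1 with hφp_def
  set Hp := H.toBlock (fun s => (upPart s).card = n ∧ (downPart s).card = n)
      (fun s => (upPart s).card = n ∧ (downPart s).card = n) with hHp_def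
  set Qp := Q.toBlock (fun s => (upPart s).card = n ∧ (downPart s).card = n)
      (fun s => (upPart s).card = n ∧ (downPart s).card = n) with hQp_def
  have hHp : Hp.IsHermitian := hH.submatrix _
  have hQp : Qp.IsHermitian := hQ.submatrix _
  have hβ : 0 < κ * (((2 * (k + 1) : ℕ)) : ℝ) := by positivity
  have hunitp : star φp ⬝ᵥ φp = 1 := by rw [hnorm, hunit]
  -- Chebyshev on the block with centre `c L⁴` and loss `θ`
  have hθcL : 0 ≤ θ * (c * (((2 * (k + 1) : ℕ)) : ℝ) ^ 4) := by positivity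
  have hring' : ((Qp - ((c * (((2 * (k + 1) : ℕ)) : ℝ) ^ 4 : ℝ) : ℂ) • 1) *
        (Qp - ((c * (((2 * (k + 1) : ℕ)) : ℝ) ^ 4 : ℝ) : ℂ) • 1) *
        Matrix.gibbsWeight (κ * (((2 * (k + 1) : ℕ)) : ℝ)) Hp).trace.re *
      (Matrix.partitionFn (κ * (((2 * (k + 1) : ℕ)) : ℝ)) Hp).re ≤
      (θ * (c * (((2 * (k + 1) : ℕ)) : ℝ) ^ 4)) ^ 2 *
        (Matrix.partitionFn (2 * (κ * (((2 * (k + 1) : ℕ)) : ℝ))) Hp).re := by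
    have h := hring
    rw [show θ * c * (((2 * (k + 1) : ℕ)) : ℝ) ^ 4 = θ * (c * (((2 * (k + 1) : ℕ)) : ℝ) ^ 4) by ring]
      at h
    exact h
  have hfloor := floor_of_ringTrace Hp Qp hHp hQp hβ hθcL hring' φp hunitp heig
  -- back to the Fock space
  have hexp' : (star φp ⬝ᵥ Qp *ᵥ φp).re = (star φ ⬝ᵥ Q *ᵥ φ).re := by rw [hexp]
  rw [hexp'] at hfloor
  calc (1 - θ) * c * (((2 * (k + 1) : ℕ)) : ℝ) ^ 4 = (1 - θ) * (c * (((2 * (k + 1) : ℕ)) : ℝ) ^ 4) := by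
        ring
    _ ≤ (star φ ⬝ᵥ Q *ᵥ φ).re := hfloor

end Summit.HubbardSuperconductivity.HubbardSuperconductivity.Cruxes.CwThesis.RingLine

end
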